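import Summits.FinalStateConjecture.FinalStateConjecture.Theorems.BartnikGapSettlingBondiBartnikRigidityProbeSectorDefs
import Literature.Geometry.Lorentzian.CausalFutureProofs
import Literature.Geometry.Lorentzian.DeviationTolerance
import Literature.Geometry.Lorentzian.NearKerrLeafMinkowskiBoostedDodge
import HarnessLib

/-!
# The probe sector (`N = 0`) of line `direct-method-on-the-cone` — crux `BondiBartnikRigidity`
# (stmt-FinalStateConjecture-10807): the registered `stub_probeSector` PROVED MODULO B1 and F4

Sorry-free reduction of the registered foreign stub `stub_probeSector` (skeleton rev 6 of
`Cruxes/BondiBartnikRigidity/Lines/direct_method_on_the_cone.lean`, signature reproduced VERBATIM as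
the conclusion of `stub_probeSector_of_facts`) to the two route-posited facts of
`…ProbeSectorDefs.lean`:

  `ProbeRoute.ProbeBartnikMassZero` (B1) → `ProbeRoute.ConeEnergyPinchesFlatSound` (F4) → stub.

Logic of the reduction (`ProbeRoute.probeSector_of_facts`): `k'` from F4 at `(k, ε)`; `γ := γ_F4 / 2`;
B1 with the gap clause gives an own cut energy `m ≤ γ_F4/2 + γ_F4/2` (`exists_hasCutBondiMass_le_of_gap`,
`p ∈ S ⊆ J⁺(ι X)` by `IsNearKerrLeaf.subset_causalFuture`); F4 gives a sound `(ε, k)`-leaf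
`S' ⊆ J⁺({p})`; sound ⇒ typed (`IsSoundNearKerrLeaf.isNearKerrLeaf`) and `J⁺({p}) ⊆ J⁺(S)`
(`causalFuture_mono`).  The hypotheses `Λ < 1`, `ε < Λ` are only passed on.

Also here, kernel-checked, the facts behind the audit of the sector:
* `ProbeRoute.isNearKerrLeaf_zero_iff` — what a `0`-hole leaf hands Lean: ONE flat chart, certified only
  through the unweighted `Cᵏ` sup of `Ψ₀^* g − η` over the whole sheet `{t₀ = 0}`;
* `ProbeRoute.upperLayer_subset_causalFuture` — the time-lifted sheets `Ψ₀{t₀ = τ}`, `0 < τ < 1`, do lie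
  in `J⁺(S)` (so the "dodge inside `J⁺(S)`" fails on certification, not on causality: nothing bounds the
  deviation off the sheet `τ = 0`, and `IsNearKerrLeaf.mono` only weakens `(k', Λ)`);
* `ProbeRoute.unit_scale_forced` — below the threshold (`ε < Λ < 1`) the flat chart of a conclusion leaf is
  an honest quasi-isometry on spatial vectors along its sheet (`DeviationTolerance`), so no collapsed
  chart can serve;
* `ProbeRoute.minkowski_conclusion` — in the Minkowski development the CONCLUSION of the stub holds for
  every `S ∋ p` (dodging leaf of `NearKerrLeafMinkowskiBoostedDodge`), so the only constructible vacuum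
  Cauchy development of the tree cannot refute the stub.

References: Bartnik, ICM 2002, Def. 4 [Bartnik2002ICM]; Christodoulou–Klainerman 1993, Ch. 17
[ChristodoulouKlainerman1993PMS41]; Chruściel–Paetz, arXiv:1401.3789 [ChruscielPaetz2014];
Choquet-Bruhat–Chruściel–Martín-García, arXiv:0905.2133 [ChoquetBruhatChruscielMartinGarcia2009];
Klainerman–Nicolò 2003 [KlainermanNicolo2003]; O'Neill 1983, Ch. 14, p. 402 [ONeillSemiRiemannian1983];
Dafermos–Holzegel–Rodnianski–Taylor, arXiv:2104.08222, §1 [DafermosHolzegelRodnianskiTaylor2021].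
-/

noncomputable section

-- D-0017: single-problem summit, `Summit.<S>.<S>.…` by design (cf. lakefile `weak.linter.dupNamespace`).
set_option linter.dupNamespace false

open Set Filter Function Topology TopologicalSpace
open Literature.Geometry.Lorentzian
open scoped Manifold ContDiff Topology ENNReal

namespace Summit.FinalStateConjecture.FinalStateConjecture.Theorems.BondiBartnikRigidity.DirectMethod

namespace ProbeRoute

/-! ### Causal glue -/

section CausalGlue

variable {X : Type} [TopologicalSpace X] [ChartedSpace E3 X] [IsManifold (𝓡 3) ∞ X]
  [ConnectedSpace X] {D : InitialDataSet (𝓡 3) X}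

/-- `J⁺({p}) ⊆ J⁺(S)` for `p ∈ S` (`causalFuture_mono`; O'Neill 1983, Ch. 14, p. 402). -/
theorem causalFuture_singleton_subset (𝒟 : VacuumCauchyDevelopment D) {S : Set 𝒟.carrier}
    {p : 𝒟.carrier} (hp : p ∈ S) :
    𝒟.metric.causalFuture 𝒟.timeOrientation ({p} : Set 𝒟.carrier) ⊆
      𝒟.metric.causalFuture 𝒟.timeOrientation S :=
  LorentzianMetric.causalFuture_mono (singleton_subset_iff.2 hp)

/-- `S' ⊆ J⁺({p})` and `p ∈ S` give `S' ⊆ J⁺(S)`. -/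
theorem subset_causalFuture_of_subset_causalFuture_singleton (𝒟 : VacuumCauchyDevelopment D)
    {S S' : Set 𝒟.carrier} {p : 𝒟.carrier}
    (h : S' ⊆ 𝒟.metric.causalFuture 𝒟.timeOrientation ({p} : Set 𝒟.carrier)) (hp : p ∈ S) :
    S' ⊆ 𝒟.metric.causalFuture 𝒟.timeOrientation S :=
  h.trans (causalFuture_singleton_subset 𝒟 hp)

/-- Two causal steps: `S' ⊆ J⁺(S₁)`, `S₁ ⊆ J⁺({p})`, `p ∈ S` give `S' ⊆ J⁺(S)`, through
`J⁺(J⁺{p}) = J⁺{p}` (`causalFuture_causalFuture_eq`; O'Neill 1983, Ch. 14, p. 402). -/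
theorem subset_causalFuture_of_two_steps (𝒟 : VacuumCauchyDevelopment D)
    {S S₁ S' : Set 𝒟.carrier} {p : 𝒟.carrier}
    (h' : S' ⊆ 𝒟.metric.causalFuture 𝒟.timeOrientation S₁)
    (h₁ : S₁ ⊆ 𝒟.metric.causalFuture 𝒟.timeOrientation ({p} : Set 𝒟.carrier)) (hp : p ∈ S) :
    S' ⊆ 𝒟.metric.causalFuture 𝒟.timeOrientation S := by
  refine h'.trans ((LorentzianMetric.causalFuture_mono h₁).trans ?_)
  rw [LorentzianMetric.causalFuture_causalFuture_eq (WithTop.coe_le_coe.mpr le_top)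
    ({p} : Set 𝒟.carrier)]
  exact causalFuture_singleton_subset 𝒟 hp

end CausalGlue

/-! ### What the hypothesis leaf gives and what the conclusion leaf demands at `N = 0` -/

section ZeroHoles

variable {X : Type} [TopologicalSpace X] [ChartedSpace E3 X] [IsManifold (𝓡 3) ∞ X]
  [ConnectedSpace X] {D : InitialDataSet (𝓡 3) X}

/-- **`N = 0` unfolding of `IsNearKerrLeaf`**: a near-Kerr leaf WITHOUT holes is exactly a flat chart
`Ψ₀` on some `U₀ ⊇ {t₀ > −1}` which is smooth on, and an open embedding of, the whole layer
`L₀ = {−1 < t₀ < 1}` into `J⁺(ι X)`, whose `Cᵏ` deviation from `η` on the whole sheet `{t₀ = 0}` is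
`≤ ε`, with `S = Ψ₀({t₀ = 0})`, the upper layer in `I⁺(S)` and the barrier clause (all hole clauses
quantify over `Fin 0`).  So the hypothesis hands Lean the metric `Ψ₀^* g` only through the UNWEIGHTED
`C^{k'}` sup over the sheet, within `Λ`; and the conclusion asks for such a chart with `ε` in place of
`Λ`. -/
theorem isNearKerrLeaf_zero_iff (𝒟 : CauchyDevelopment D) (k : ℕ) (ε : ℝ≥0∞) (M a : Fin 0 → ℝ)
    (S : Set 𝒟.carrier) :
    𝒟.IsNearKerrLeaf k ε 0 M a S ↔
      ∃ (U₀ : Opens E4) (Ψ₀ : (hypBackground U₀).domain → 𝒟.carrier),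
        {x : E4 | -1 < x 0 - Real.sqrt (1 + E4.spatialNorm x ^ 2)} ⊆ (U₀ : Set E4) ∧
        ContMDiffOn 𝓘(ℝ, E4) (𝓡 4) ∞ Ψ₀
          {x | -1 < (hypBackground U₀).time x.1 ∧ (hypBackground U₀).time x.1 < 1} ∧
        IsOpenEmbedding
          ({x | -1 < (hypBackground U₀).time x.1 ∧ (hypBackground U₀).time x.1 < 1}.restrict Ψ₀) ∧
        Ψ₀ '' {x | -1 < (hypBackground U₀).time x.1 ∧ (hypBackground U₀).time x.1 < 1} ⊆
          𝒟.metric.causalFuture 𝒟.timeOrientation (range 𝒟.embed) ∧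
        𝒟.toSpacetime.deviationCk (hypBackground U₀) Ψ₀ k 0 ≤ ε ∧
        S = Ψ₀ '' (hypBackground U₀).timeSlab 0 ∧
        Ψ₀ '' {x | 0 < (hypBackground U₀).time x.1 ∧ (hypBackground U₀).time x.1 < 1} ⊆
          𝒟.metric.chronologicalFuture 𝒟.timeOrientation S ∧
        𝒟.exteriorOf (Ψ₀ '' {x | 0 < (hypBackground U₀).time x.1 ∧ (hypBackground U₀).time x.1 < 1}) \
            Ψ₀ '' {x | 0 < (hypBackground U₀).time x.1 ∧ (hypBackground U₀).time x.1 < 1} ⊆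
          𝒟.metric.causalPast 𝒟.timeOrientation S := by
  constructor
  · rintro ⟨R, ρ, mo, r, B, U₀, B₀, Ψ, Ψ₀, L, W, L₀, W₀, -, -, hB₀, -, hL₀, hW₀, -, hU₀, -, hΨ₀,
      hΨ₀e, hΨ₀J, -, hdev₀, -, -, -, hS, hWI, hbar⟩
    subst hB₀ hL₀ hW₀
    simp only [Set.iUnion_of_empty, Set.union_empty] at hS hWI hbar
    exact ⟨U₀, Ψ₀, fun x hx => hU₀ ⟨hx, fun i => i.elim0⟩, hΨ₀, hΨ₀e, hΨ₀J, hdev₀, hS, hWI, hbar⟩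
  · rintro ⟨U₀, Ψ₀, hU₀, hΨ₀, hΨ₀e, hΨ₀J, hdev₀, hS, hWI, hbar⟩
    refine ⟨Fin.elim0, Fin.elim0, Fin.elim0, Fin.elim0, Fin.elim0, U₀, hypBackground U₀,
      fun i => i.elim0, Ψ₀, fun i => i.elim0, fun i => i.elim0, _, _, fun i => i.elim0,
      fun i => i.elim0, rfl, fun i => i.elim0, rfl, rfl, fun i => i.elim0,
      fun x hx => hU₀ hx.1, fun i => i.elim0, hΨ₀, hΨ₀e, hΨ₀J, fun i => i.elim0, hdev₀,
      fun i => i.elim0, fun i => i.elim0, fun i => i.elim0, ?_, ?_, ?_⟩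
    · simpa only [Set.iUnion_of_empty, Set.union_empty] using hS
    · simpa only [Set.iUnion_of_empty, Set.union_empty] using hWI
    · simpa only [Set.iUnion_of_empty, Set.union_empty] using hbar

/-- **The time-lifted sheets lie in `J⁺(S)`** (causal half of the "dodge inside `J⁺(S)`" question,
which holds): for a `0`-hole leaf with flat chart `Ψ₀`, every sheet `Ψ₀{t₀ = τ}`, `0 < τ < 1`, lies in
the upper layer, hence in `I⁺(S) ⊆ J⁺(S)`.  (The certification half fails: the leaf bounds the
deviation on the sheet `τ = 0` only, so nothing makes `Ψ₀(· + τ e₀)` an `(ε, k)`-chart for `ε < Λ`.) -/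
theorem upperLayer_subset_causalFuture (𝒟 : CauchyDevelopment D) {S : Set 𝒟.carrier}
    {U₀ : Opens E4} {Ψ₀ : (hypBackground U₀).domain → 𝒟.carrier}
    (hWI : Ψ₀ '' {x | 0 < (hypBackground U₀).time x.1 ∧ (hypBackground U₀).time x.1 < 1} ⊆
      𝒟.metric.chronologicalFuture 𝒟.timeOrientation S) {τ : ℝ} (hτ0 : 0 < τ) (hτ1 : τ < 1) :
    Ψ₀ '' (hypBackground U₀).timeSlab τ ⊆ 𝒟.metric.causalFuture 𝒟.timeOrientation S := by
  refine (image_mono fun x hx => ?_).trans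
    (hWI.trans (LorentzianMetric.chronologicalFuture_subset_causalFuture _ _ S))
  rw [ModelBackground.mem_timeSlab] at hx
  exact ⟨hx ▸ hτ0, hx ▸ hτ1⟩

/-- **Monotonicity only weakens**: the hypothesis leaf is an `(Λ, k)`-leaf for every `k ≤ k'`
(`IsNearKerrLeaf.mono`), in its own causal future — the trivial regime `Λ ≤ ε`, which the probe sector
(`ε < Λ`) excludes. -/
theorem self_witness_of_le (𝒟 : CauchyDevelopment D) {k k' : ℕ} {ε Λ : ℝ≥0∞} {M a : Fin 0 → ℝ}
    {S : Set 𝒟.carrier} (h : 𝒟.IsNearKerrLeaf k' Λ 0 M a S) (hk : k ≤ k') (hΛ : Λ ≤ ε) :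
    ∃ S' : Set 𝒟.carrier, 𝒟.IsNearKerrLeaf k ε 0 M a S' ∧
      S' ⊆ 𝒟.metric.causalFuture 𝒟.timeOrientation S :=
  ⟨S, h.mono hk hΛ, LorentzianMetric.subset_causalFuture _ _ S⟩

/-- **Unit scale is forced below the threshold** (no "collapsed chart" escape for `ε < 1`): if the
flat chart of a `0`-hole `(ε, k)`-leaf has `deviationCk ≤ ε` with `ε < Λ < 1`, then at every sheet
point `dΨ₀` maps each spatial coordinate vector `v` (`v⁰ = 0`) to a vector with
`g(dΨ₀ v, dΨ₀ v) ≥ (1 − ε) ‖v‖²` (`Spacetime.le_pullback_of_apply_zero_eq_zero`). -/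
theorem unit_scale_forced {𝓢 : Spacetime.{0} 4} {U₀ : Opens E4}
    (Ψ₀ : (hypBackground U₀).domain → 𝓢.carrier) (k : ℕ) {ε Λ : ℝ≥0∞} (hεΛ : ε < Λ) (hΛ : Λ < 1)
    (hdev : 𝓢.deviationCk (hypBackground U₀) Ψ₀ k 0 ≤ ε) {x : (hypBackground U₀).domain}
    (hx : x ∈ (hypBackground U₀).timeSlab 0) {v : E4} (hv : v 0 = 0) :
    (1 - ε.toReal) * ‖v‖ ^ 2 ≤
      𝓢.metric.val (Ψ₀ x) (mfderiv 𝓘(ℝ, E4) (𝓡 4) Ψ₀ x v) (mfderiv 𝓘(ℝ, E4) (𝓡 4) Ψ₀ x v) := by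
  have hε1 : ε < 1 := hεΛ.trans hΛ
  have hεtop : ε ≠ ⊤ := (hε1.trans ENNReal.one_lt_top).ne
  have hdev' : 𝓢.deviationCk (hypBackground U₀) Ψ₀ k 0 ≤ ENNReal.ofReal ε.toReal := by
    rwa [ENNReal.ofReal_toReal hεtop]
  exact 𝓢.le_pullback_of_apply_zero_eq_zero U₀ Ψ₀ k ENNReal.toReal_nonneg hdev' hx hv

end ZeroHoles

/-! ### The registered signature, proved modulo B1 and F4 -/

/-- **B1 and F4 give the probe sector** (`γ := γ_F4/2`, `η := γ`; sound ⇒ typed; `J⁺{p} ⊆ J⁺(S)`).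
The conclusion is the registered signature of `stub_probeSector`, verbatim. -/
theorem probeSector_of_facts (hB1 : ProbeBartnikMassZero) (hF : ConeEnergyPinchesFlatSound) :
    ∀ (k : ℕ) (ε : ℝ≥0∞), 0 < ε →
    ∃ k' : ℕ, ∀ Λ : ℝ≥0∞, Λ < 1 → ε < Λ → ∃ γ : ℝ, 0 < γ ∧
    ∀ (X : Type) [TopologicalSpace X] [ChartedSpace E3 X] [IsManifold (𝓡 3) ∞ X]
      [T2Space X] [SecondCountableTopology X] [ConnectedSpace X],
    ∀ D ∈ admissibleVacuumData X, ∀ (𝒟 : VacuumCauchyDevelopment D) (M a : Fin 0 → ℝ)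
      (S : Set 𝒟.carrier) (p : 𝒟.carrier),
    𝒟.IsMaximal → 𝒟.toCauchyDevelopment.IsNearKerrLeaf k' Λ 0 M a S → p ∈ S →
    (∃ m : ℝ, 𝒟.toCauchyDevelopment.HasCutBondiMass ({p} : Set 𝒟.carrier) m) →
    𝒟.BondiBartnikGapLE ({p} : Set 𝒟.carrier) γ →
    ∃ S' : Set 𝒟.carrier, 𝒟.toCauchyDevelopment.IsNearKerrLeaf k ε 0 M a S' ∧
      S' ⊆ 𝒟.metric.causalFuture 𝒟.timeOrientation S := by
  intro k ε hε
  obtain ⟨k', hF'⟩ := hF k ε hε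
  refine ⟨k', fun Λ hΛ1 _hεΛ => ?_⟩
  obtain ⟨γ, hγ, hF''⟩ := hF' Λ hΛ1
  refine ⟨γ / 2, by positivity, ?_⟩
  intro X _ _ _ _ _ _ D hD 𝒟 M a S p hmax hleaf hp _hcut hgap
  obtain ⟨m, hm, hmle⟩ := exists_hasCutBondiMass_le_of_gap 𝒟
    (hB1 X D hD 𝒟 p hmax (hleaf.subset_causalFuture hp)) hgap (half_pos hγ)
  obtain ⟨S', hS', hS'p⟩ := hF'' X D hD 𝒟 M a S p m hmax hleaf hp hm (by linarith)
  exact ⟨S', hS'.isNearKerrLeaf, subset_causalFuture_of_subset_causalFuture_singleton 𝒟 hS'p hp⟩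

/-! ### Sanity: the Minkowski instance of the conclusion (anti-refutation) -/

/-- In the Minkowski development the CONCLUSION of the probe sector holds for every set `S ∋ p`: a
dodging `(ε, k)`-leaf inside `J⁺({p}) ⊆ J⁺(S)`
(`Minkowski.exists_isNearKerrLeaf_subset_causalFuture_forall_dist_lt`), so no refutation of the stub can
come from the only constructible vacuum Cauchy development of the tree (O'Neill 1983, Ch. 14, p. 402). -/
theorem minkowski_conclusion (k : ℕ) {ε : ℝ≥0∞} (hε : 0 < ε) (M a : Fin 0 → ℝ) (S : Set E4)
    {p : E4} (hp : p ∈ S) :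
    ∃ S' : Set E4, Minkowski.vacuumCauchyDevelopment.toCauchyDevelopment.IsNearKerrLeaf k ε 0 M a S' ∧
      S' ⊆ Minkowski.vacuumCauchyDevelopment.metric.causalFuture
        Minkowski.vacuumCauchyDevelopment.timeOrientation S := by
  obtain ⟨S', hS', hS'p, -, -⟩ :=
    Minkowski.exists_isNearKerrLeaf_subset_causalFuture_forall_dist_lt k hε p 0 0
  have hM : M = ![] := Subsingleton.elim _ _
  have ha : a = ![] := Subsingleton.elim _ _
  subst hM ha
  exact ⟨S', hS', hS'p.trans (LorentzianMetric.causalFuture_mono (singleton_subset_iff.2 hp))⟩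

end ProbeRoute

/-- **Registered brick of the line** (`stub_probeSector_of_facts`): the foreign stub `stub_probeSector`
of skeleton rev 6, signature VERBATIM, proved modulo the two route-posited facts B1
(`ProbeRoute.ProbeBartnikMassZero`) and F4 (`ProbeRoute.ConeEnergyPinchesFlatSound`) — the term to
splice in place of the skeleton's `sorry` once both are theorems. [conjecture] [folklore] -/
theorem stub_probeSector_of_facts : ProbeRoute.ProbeBartnikMassZero → ProbeRoute.ConeEnergyPinchesFlatSound →
    ∀ (k : ℕ) (ε : ℝ≥0∞), 0 < ε →
    ∃ k' : ℕ, ∀ Λ : ℝ≥0∞, Λ < 1 → ε < Λ → ∃ γ : ℝ, 0 < γ ∧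
    ∀ (X : Type) [TopologicalSpace X] [ChartedSpace E3 X] [IsManifold (𝓡 3) ∞ X]
      [T2Space X] [SecondCountableTopology X] [ConnectedSpace X],
    ∀ D ∈ admissibleVacuumData X, ∀ (𝒟 : VacuumCauchyDevelopment D) (M a : Fin 0 → ℝ)
      (S : Set 𝒟.carrier) (p : 𝒟.carrier),
    𝒟.IsMaximal → 𝒟.toCauchyDevelopment.IsNearKerrLeaf k' Λ 0 M a S → p ∈ S →
    (∃ m : ℝ, 𝒟.toCauchyDevelopment.HasCutBondiMass ({p} : Set 𝒟.carrier) m) →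
    𝒟.BondiBartnikGapLE ({p} : Set 𝒟.carrier) γ →
    ∃ S' : Set 𝒟.carrier, 𝒟.toCauchyDevelopment.IsNearKerrLeaf k ε 0 M a S' ∧
      S' ⊆ 𝒟.metric.causalFuture 𝒟.timeOrientation S :=
  fun hB1 hF ↦ ProbeRoute.probeSector_of_facts hB1 hF

end Summit.FinalStateConjecture.FinalStateConjecture.Theorems.BondiBartnikRigidity.DirectMethod

end
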